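import Literature.NumberTheory.Sieve.HeathBrownCubicUpperBoundIdealTools
import Literature.NumberTheory.LFunctions.IdealNormCount
import HarnessLib

/-!
# The corrected Lemma 7.1 in weighted form, and the analytic bookkeeping of §7, p. 41

Pure-proof file (no definitions) in the decomposition of **parity.S18** along D. R. Heath-Brown,
*Primes represented by `x³ + 2y³`*, Acta Math. 186 (2001), 1–84; it sits between
`HeathBrownCubicUpperBoundIdealTools` and `HeathBrownCubicUpperBoundProofs` (Lemma 3.6 ⇐ Lemma 7.1).

Heath-Brown's Lemma 7.1 is vendored in the corrected form `HeathBrown2001_lemma_7_1_normWeighted`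
(`HeathBrownCubicUpperBound`): sums over ALL ideals whose norm lies in a set `𝒬`, weight
`∑_{N(Q)∈𝒬} N(Q)^{-1}`. The applications on pp. 41–42 sum over sub-families of those ideals (the prime
ideals `P` of a Buchstab range, the ideals `P_1P_2`, `P_1P_2P_3` indexed by the `U`-pieces). By
non-negativity such a sub-family is bounded by the total over all ideals of the norms it meets, and
there are `c_K(q)` ideals of norm `q` (`Literature.NumberTheory.LFunctions.idealNormCount`, multiplicative,
`c_K(p) ≤ 2^{[K:ℚ]} = 8`), so the corrected lemma yields, for EVERY finite set `𝒮` of ideals with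
square-free norms in `(N, 2N]`, the bound with weight `∑_{Q∈𝒮} c_K(N(Q))/N(Q)`
(`weightForm_of_normWeighted`), and `c_K(N(Q))/N(Q) ≤ 8^k/N(Q)` when `N(Q)` is a product of `k`
distinct primes (`normWeight_prime_le`, `normWeight_uIdeal_le`). The tools of
`HeathBrownCubicUpperBoundIdealTools` are re-proved for an arbitrary non-negative weight `w`
(`dyadic_sum_weight_le`, `primeRangeSum_boxPairs_weight_le`, `primeRangeSum_normWindow_weight_le`,
`sum_good_weight_le`), and the analytic bookkeeping common to the four pieces of Lemma 3.6 is done once: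

* `absorb_le` — `T·X²X^{−δ}(log X)^j ≤ T·τη²X²/log X` for `δ ≥ τ/5`, `j ≤ 3`, from
  `X^{−τ/5}(log X)³ ≤ τη²/log X` ("by (2.1) and (2.5)", p. 41);
* `primeRange_piece_le` — `S(𝒜-range) + κ S(ℬ-range) ≤ const·τη²X²/log X` for a single-prime range
  `[a, b)` given the window bound `3(log(2b/a) + K₁)/log(a/2) ≤ W_c τ` and `(√b + 1)/a ≤ 3X^{−1/4}`;
* `uPiece_pair_le` — the same for a `U`-piece given the reciprocal sums over its good (`≤ W_c τ`) and
  defective (`≤ W_b (log X)² X^{−1/15}`) indices;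
* small numerical facts at `X ≥ 2^{15}` (`ten_le_log`, `log_div_log_two_add_one_le`, `rpow_two_sub`,
  `rpow_three_sub`, `rpow_lower_bounds`).

Here `κ = σ₀η(3X)^{-1}` (`kappa`), `#ℬ^(K)_R ≤ C_ℬX³/N(R)` (`exists_countB_le`), and the constants are
explicit polynomials in Lemma 7.1's constant `C₇`, `σ₀`, `C_ℬ` and the Mertens constant `K₁`.

## References

* D. R. Heath-Brown, *Primes represented by `x³ + 2y³`*, Acta Math. 186 (2001), 1–84: Lemma 7.1
  (p. 39), §7 pp. 41–42. [cite: HeathBrownActa2001, §7 pp. 41–42]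

## Mathlib / tree search

Mathlib: `Real.rpow_*`, `Finset.sum_fiberwise_of_maps_to`, `Finset.sum_image_le_of_nonneg`,
`Nat.card_congr`, `Nat.card_eq_finsetCard`, `Nat.Coprime.prod_right`, `Nat.coprime_primes`. Tree:
`Literature.NumberTheory.LFunctions.idealNormCount` with `idealNormCount_mul_of_coprime`,
`idealNormCount_prime_le` (`LFunctions/IdealNormCount.lean`), `HeathBrownCubicUpperBoundIdealTools`,
`HeathBrownCubicUpperBoundTools` (`dyadIdx`, `normIn`, `uIdeal`, `UGood`, `sum_inv_absNorm_window_le`,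
`card_filter_not_prime_absNorm_le`, `sum_filter_UGood_boxPairs`, `sum_filter_not_UGood_normWindow_le`),
`HeathBrownCubicSieveDecomposition` (`kappa` via `HeathBrownCubicPrimesOutline`, `Upairs`, `primeRangeSum`).
-/

noncomputable section

open Polynomial NumberField Finset Filter Topology Asymptotics
open scoped nonZeroDivisors

namespace Literature.NumberTheory.Sieve.CubicSieve

open LFunctions.CubeRootTwoField CubicPrimes
open Literature.NumberTheory.LFunctions (idealNormCount idealNormCount_def idealNormCount_one
  idealNormCount_mul_of_coprime idealNormCount_prime_le)

/-! ### Absorption of polynomially small terms into `τη²X²/log X` -/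

/-- **Absorption**: if `X^{−τ/5}(log X)³ ≤ τη²/log X`, then every term `T·X²·X^{−δ}(log X)^j` with
`δ ≥ τ/5`, `j ≤ 3`, `T ≥ 0` is at most `T·τη²X²/log X` (p. 41: "by (2.1) and (2.5)"). [folklore] -/
theorem absorb_le {X τ η L T δ : ℝ} {j : ℕ} (hX : 1 ≤ X) (hL1 : 1 ≤ L) (hT : 0 ≤ T)
    (hδ : τ / 5 ≤ δ) (hj : j ≤ 3) (habs : X ^ (-τ / 5) * L ^ 3 ≤ τ * η ^ 2 / L) :
    T * (X ^ 2 * X ^ (-δ) * L ^ j) ≤ T * (τ * η ^ 2 * X ^ 2 / L) := by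
  refine mul_le_mul_of_nonneg_left ?_ hT
  have h1 : X ^ (-δ) ≤ X ^ (-τ / 5) := Real.rpow_le_rpow_of_exponent_le hX (by linarith)
  have h2 : L ^ j ≤ L ^ 3 := pow_le_pow_right₀ hL1 hj
  have hX2 : 0 ≤ X ^ 2 := by positivity
  calc X ^ 2 * X ^ (-δ) * L ^ j ≤ X ^ 2 * (X ^ (-τ / 5) * L ^ 3) := by
        rw [mul_assoc]
        refine mul_le_mul_of_nonneg_left ?_ hX2
        exact mul_le_mul h1 h2 (by positivity) (Real.rpow_nonneg (by linarith) _)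
    _ ≤ X ^ 2 * (τ * η ^ 2 / L) := mul_le_mul_of_nonneg_left habs hX2
    _ = τ * η ^ 2 * X ^ 2 / L := by ring

/-- `log 2^{15} ≥ 10`, so `log X ≥ 10` for `X ≥ 2^{15}`. [folklore] -/
theorem ten_le_log {X : ℝ} (hX : (2 : ℝ) ^ 15 ≤ X) : 10 ≤ Real.log X := by
  have h2 : Real.log ((2 : ℝ) ^ 15) = 15 * Real.log 2 := by
    rw [Real.log_pow]; norm_num
  have hl2 := Real.log_two_gt_d9
  calc (10 : ℝ) ≤ 15 * Real.log 2 := by linarith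
    _ = Real.log ((2 : ℝ) ^ 15) := h2.symm
    _ ≤ Real.log X := Real.log_le_log (by positivity) hX

/-- `log b / log 2 + 1 ≤ 3 log X` for `1 ≤ b ≤ X²` (`b` real), `log X ≥ 10`. [folklore] -/
theorem log_div_log_two_add_one_le {b L X : ℝ} (hb1 : 1 ≤ b) (hbX : b ≤ X ^ 2)
    (hL : L = Real.log X) (hL10 : 10 ≤ L) : Real.log b / Real.log 2 + 1 ≤ 3 * L := by
  have hl2 := Real.log_two_gt_d9
  have hlogb : Real.log b ≤ 2 * L := by
    have h := Real.log_le_log (by linarith) hbX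
    rw [Real.log_pow] at h
    rw [hL]; push_cast at h; linarith
  have hlogb0 : 0 ≤ Real.log b := Real.log_nonneg hb1
  have h1 : Real.log b / Real.log 2 ≤ Real.log b / 0.69 :=
    div_le_div_of_nonneg_left hlogb0 (by norm_num) (by linarith)
  have h2 : Real.log b / 0.69 ≤ 2 * L / 0.69 := div_le_div_of_nonneg_right hlogb (by norm_num)
  have h3 : 2 * L / 0.69 + 1 ≤ 3 * L := by
    rw [div_add_one (by norm_num), div_le_iff₀ (by norm_num)]
    linarith
  linarith

/-- `X^{2 − s} = X²·X^{−s}` for `X > 0`. [folklore] -/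
theorem rpow_two_sub {X : ℝ} (hX : 0 < X) (s : ℝ) : X ^ (2 - s) = X ^ 2 * X ^ (-s) := by
  rw [sub_eq_add_neg, Real.rpow_add hX, Real.rpow_two]

/-- `X^{3 − s} = X³·X^{−s}` for `X > 0`. [folklore] -/
theorem rpow_three_sub {X : ℝ} (hX : 0 < X) (s : ℝ) : X ^ (3 - s) = X ^ 3 * X ^ (-s) := by
  rw [sub_eq_add_neg, Real.rpow_add hX, show (3 : ℝ) = ((3 : ℕ) : ℝ) by norm_num, Real.rpow_natCast]

/-! ### Weighted forms of the Lemma 7.1 application tools -/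

/-- **Lemma 7.1 with a general weight, summed dyadically** (as `dyadic_sum_ideal_le`, with the weight
`N(Q)^{-1}` replaced by an arbitrary non-negative weight `w(Q)`; the corrected Lemma 7.1 supplies
`w(Q) = c_K(N(Q))/N(Q)`, `c_K(q)` the number of ideals of norm `q`, for sub-families of the ideals of
given norms). [cite: HeathBrownActa2001, §7 pp. 41–42] -/
theorem dyadic_sum_weight_le {X τ z C M Err a b : ℝ} {S w : Ideal (𝓞 K) → ℝ} (hw0 : ∀ Q, 0 ≤ w Q)
    (h71 : ∀ (N : ℝ) (𝒮 : Finset (Ideal (𝓞 K))), 0 < N → N ≤ X ^ (2 - 2 * τ) →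
        (∀ Q ∈ 𝒮, Squarefree (Ideal.absNorm Q) ∧ N < (Ideal.absNorm Q : ℝ) ∧
          (Ideal.absNorm Q : ℝ) ≤ 2 * N) →
        ∑ Q ∈ 𝒮, S Q ≤ C * (M / Real.log (min z (X ^ (2 - τ) / N)) * ∑ Q ∈ 𝒮, w Q + Err))
    (hC : 0 ≤ C) (hM : 0 ≤ M) (hErr : 0 ≤ Err) (hX : 0 < X) (ha : 2 ≤ a) (hab : a ≤ b)
    (hb : b ≤ X ^ (2 - 2 * τ)) (hm : 1 < min z (X ^ (2 - τ) / b))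
    (𝒮 : Finset (Ideal (𝓞 K)))
    (h𝒮 : ∀ Q ∈ 𝒮, Squarefree (Ideal.absNorm Q) ∧ a ≤ (Ideal.absNorm Q : ℝ) ∧ (Ideal.absNorm Q : ℝ) < b) :
    ∑ Q ∈ 𝒮, S Q ≤
      C * (M / Real.log (min z (X ^ (2 - τ) / b)) * ∑ Q ∈ 𝒮, w Q) +
        (Real.log b / Real.log 2 + 1) * (C * Err) := by
  classical
  set ℓ : ℝ := Real.log (min z (X ^ (2 - τ) / b)) with hℓ
  have hℓ0 : 0 < ℓ := Real.log_pos hm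
  have hb2 : 2 ≤ b := ha.trans hab
  have hXp : 0 < X ^ (2 - τ) := Real.rpow_pos_of_pos hX _
  have hq2 : ∀ Q ∈ 𝒮, 2 ≤ Ideal.absNorm Q := fun Q hQ => by
    have h := ha.trans (h𝒮 Q hQ).2.1
    exact_mod_cast h
  set J : Finset ℕ := 𝒮.image fun Q => dyadIdx (Ideal.absNorm Q) with hJ
  set blk : ℕ → Finset (Ideal (𝓞 K)) := fun j => 𝒮.filter fun Q => dyadIdx (Ideal.absNorm Q) = j
    with hblk
  have hblock : ∀ j ∈ J, ∑ Q ∈ blk j, S Q ≤ C * (M / ℓ * ∑ Q ∈ blk j, w Q) + C * Err := by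
    intro j hj
    obtain ⟨Q₀, hQ₀, hjQ₀⟩ := mem_image.mp hj
    have hNpos : (0 : ℝ) < (2 : ℝ) ^ j := by positivity
    have hNb : (2 : ℝ) ^ j < b := by
      calc (2 : ℝ) ^ j = ((2 ^ dyadIdx (Ideal.absNorm Q₀) : ℕ) : ℝ) := by rw [← hjQ₀]; push_cast; ring
        _ < (Ideal.absNorm Q₀ : ℕ) := by exact_mod_cast pow_dyadIdx_lt (hq2 Q₀ hQ₀)
        _ < b := (h𝒮 Q₀ hQ₀).2.2
    have hNX : (2 : ℝ) ^ j ≤ X ^ (2 - 2 * τ) := hNb.le.trans hb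
    have hmem : ∀ Q ∈ blk j, Squarefree (Ideal.absNorm Q) ∧ (2 : ℝ) ^ j < (Ideal.absNorm Q : ℝ) ∧
        (Ideal.absNorm Q : ℝ) ≤ 2 * (2 : ℝ) ^ j := by
      intro Q hQ
      rw [hblk, mem_filter] at hQ
      obtain ⟨hQ𝒮, hQj⟩ := hQ
      refine ⟨(h𝒮 Q hQ𝒮).1, ?_, ?_⟩
      · calc (2 : ℝ) ^ j = ((2 ^ dyadIdx (Ideal.absNorm Q) : ℕ) : ℝ) := by rw [← hQj]; push_cast; ring
          _ < (Ideal.absNorm Q : ℕ) := by exact_mod_cast pow_dyadIdx_lt (hq2 Q hQ𝒮)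
      · calc ((Ideal.absNorm Q : ℕ) : ℝ) ≤ ((2 ^ (dyadIdx (Ideal.absNorm Q) + 1) : ℕ) : ℝ) := by
              exact_mod_cast le_pow_dyadIdx_succ _
          _ = 2 * (2 : ℝ) ^ j := by rw [← hQj]; push_cast; ring
    have h := h71 ((2 : ℝ) ^ j) (blk j) hNpos hNX hmem
    have hmin : min z (X ^ (2 - τ) / b) ≤ min z (X ^ (2 - τ) / (2 : ℝ) ^ j) :=
      min_le_min le_rfl (div_le_div_of_nonneg_left hXp.le hNpos hNb.le)
    have hlog : ℓ ≤ Real.log (min z (X ^ (2 - τ) / (2 : ℝ) ^ j)) :=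
      Real.log_le_log (zero_lt_one.trans hm) hmin
    have hsum0 : 0 ≤ ∑ Q ∈ blk j, w Q := sum_nonneg fun Q _ => hw0 Q
    calc ∑ Q ∈ blk j, S Q
        ≤ C * (M / Real.log (min z (X ^ (2 - τ) / (2 : ℝ) ^ j)) * ∑ Q ∈ blk j, w Q + Err) := h
      _ ≤ C * (M / ℓ * ∑ Q ∈ blk j, w Q + Err) := by
          have : M / Real.log (min z (X ^ (2 - τ) / (2 : ℝ) ^ j)) ≤ M / ℓ :=
            div_le_div_of_nonneg_left hM hℓ0 hlog
          gcongr
      _ = C * (M / ℓ * ∑ Q ∈ blk j, w Q) + C * Err := by ring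
  have hLHS : ∑ Q ∈ 𝒮, S Q = ∑ j ∈ J, ∑ Q ∈ blk j, S Q := by
    rw [hblk]
    exact (sum_fiberwise_of_maps_to (g := fun Q => dyadIdx (Ideal.absNorm Q))
      (fun Q hQ => mem_image_of_mem (fun Q => dyadIdx (Ideal.absNorm Q)) hQ) _).symm
  have hrecip : ∑ j ∈ J, ∑ Q ∈ blk j, w Q = ∑ Q ∈ 𝒮, w Q := by
    rw [hblk]
    exact sum_fiberwise_of_maps_to (g := fun Q => dyadIdx (Ideal.absNorm Q))
      (fun Q hQ => mem_image_of_mem (fun Q => dyadIdx (Ideal.absNorm Q)) hQ) _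
  have hcardJ : (#J : ℝ) ≤ Real.log b / Real.log 2 + 1 := by
    have hsub : J ⊆ range (⌊Real.log b / Real.log 2⌋₊ + 1) := by
      intro j hj
      obtain ⟨Q₀, hQ₀, rfl⟩ := mem_image.mp hj
      rw [mem_range, Nat.lt_add_one_iff]
      exact Nat.le_floor (dyadIdx_le_log (hq2 Q₀ hQ₀) (h𝒮 Q₀ hQ₀).2.2)
    have hlog0 : 0 ≤ Real.log b / Real.log 2 :=
      div_nonneg (Real.log_nonneg (by linarith)) (Real.log_nonneg one_le_two)
    calc (#J : ℝ) ≤ #(range (⌊Real.log b / Real.log 2⌋₊ + 1)) := by exact_mod_cast card_le_card hsub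
      _ = (⌊Real.log b / Real.log 2⌋₊ : ℝ) + 1 := by rw [card_range]; push_cast; ring
      _ ≤ Real.log b / Real.log 2 + 1 := by linarith [Nat.floor_le hlog0]
  calc ∑ Q ∈ 𝒮, S Q = ∑ j ∈ J, ∑ Q ∈ blk j, S Q := hLHS
    _ ≤ ∑ j ∈ J, (C * (M / ℓ * ∑ Q ∈ blk j, w Q) + C * Err) := sum_le_sum hblock
    _ = C * (M / ℓ * ∑ Q ∈ 𝒮, w Q) + #J * (C * Err) := by
        rw [sum_add_distrib, sum_const, nsmul_eq_mul, ← hrecip, mul_sum, mul_sum]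
    _ ≤ C * (M / ℓ * ∑ Q ∈ 𝒮, w Q) + (Real.log b / Real.log 2 + 1) * (C * Err) := by
        have : 0 ≤ M / ℓ * ∑ Q ∈ 𝒮, w Q := mul_nonneg (div_nonneg hM hℓ0.le) (sum_nonneg fun Q _ => hw0 Q)
        gcongr

/-- **The single-prime pieces `S₃(𝒜)`, `S₅(𝒜)` via Lemma 7.1 with a general weight** (as
`primeRangeSum_boxPairs_ideal_le`; the weight `N(P)^{-1}` is replaced by `w(P)` over the first-degree
primes of the range). [cite: HeathBrownActa2001, §7 p. 41] -/
theorem primeRangeSum_boxPairs_weight_le {X η τ C a b : ℝ} {w : Ideal (𝓞 K) → ℝ}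
    (hw0 : ∀ Q, 0 ≤ w Q) (hX : 16 ≤ X) (hC : 0 ≤ C)
    (ha : X ^ (1 / 2 : ℝ) ≤ a) (hab : a ≤ b) (hb : b ≤ X ^ (2 - 2 * τ))
    (hm : X ^ (1 / 4 : ℝ) ≤ min (X ^ (1 / 2 : ℝ)) (X ^ (2 - τ) / b))
    (h71A : ∀ (N : ℝ) (𝒮 : Finset (Ideal (𝓞 K))), 0 < N → N ≤ X ^ (2 - 2 * τ) →
        (∀ Q ∈ 𝒮, Squarefree (Ideal.absNorm Q) ∧ N < (Ideal.absNorm Q : ℝ) ∧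
          (Ideal.absNorm Q : ℝ) ≤ 2 * N) →
        ∑ Q ∈ 𝒮, (siftedA X η Q (X ^ (1 / 2 : ℝ)) : ℝ) ≤
          C * (η ^ 2 * X ^ 2 / Real.log (min (X ^ (1 / 2 : ℝ)) (X ^ (2 - τ) / N)) *
            ∑ Q ∈ 𝒮, w Q + X ^ (2 - τ / 5))) :
    (primeRangeSum (boxPairs X η) pairIdeal a b : ℝ) ≤
      C * (η ^ 2 * X ^ 2 / Real.log (X ^ (1 / 4 : ℝ))) *
          ∑ P ∈ (primesNormIco a b).filter (fun P => (Ideal.absNorm P).Prime), w P +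
        (Real.log b / Real.log 2 + 1) * (C * X ^ (2 - τ / 5)) := by
  classical
  have hX0 : 0 < X := by linarith
  have hX1 : 1 < X := by linarith
  set z : ℝ := X ^ (1 / 2 : ℝ) with hz
  have hz4 : 4 ≤ z := by
    calc (4 : ℝ) = (16 : ℝ) ^ (1 / 2 : ℝ) := by
          rw [show (16 : ℝ) = 4 ^ (2 : ℝ) by norm_num, ← Real.rpow_mul (by norm_num)]; norm_num
      _ ≤ X ^ (1 / 2 : ℝ) := Real.rpow_le_rpow (by norm_num) hX (by norm_num)
  have ha2 : 2 ≤ a := by linarith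
  have hX14 : 1 < X ^ (1 / 4 : ℝ) := Real.one_lt_rpow hX1 (by norm_num)
  have hm1 : 1 < min (X ^ (1 / 2 : ℝ)) (X ^ (2 - τ) / b) := lt_of_lt_of_le hX14 hm
  set Pset := primesNormIco a b with hPset
  have step1 : (primeRangeSum (boxPairs X η) pairIdeal a b : ℝ) ≤
      ∑ P ∈ Pset, (famSifted (boxPairs X η) pairIdeal P z : ℝ) := by
    rw [primeRangeSum, Nat.cast_sum]
    refine sum_le_sum fun P hP => ?_
    have hNP : z ≤ Ideal.absNorm P := ha.trans ((mem_primesNormIco_iff.mp hP).2.2.1)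
    exact_mod_cast famSiftedAbove_le_famSifted _ _ P P hNP
  set good := Pset.filter fun P => (Ideal.absNorm P).Prime with hgood
  have step2 : ∑ P ∈ Pset, (famSifted (boxPairs X η) pairIdeal P z : ℝ) =
      ∑ P ∈ good, (siftedA X η P z : ℝ) := by
    rw [hgood, sum_filter_of_ne]
    · exact sum_congr rfl fun P _ => by rw [siftedA_eq_famSifted]
    intro P hP hne
    by_contra hnp
    obtain ⟨hPp, hP0, -, -⟩ := mem_primesNormIco_iff.mp hP
    have h0 : famSifted (boxPairs X η) pairIdeal P z = 0 := by
      have h := famSifted_le_famCount (boxPairs X η) pairIdeal P z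
      rw [famCount_boxPairs, countA_eq_zero_of_not_prime hPp hP0 dvd_rfl hnp] at h
      exact Nat.le_zero.mp h
    exact hne (by rw [siftedA_eq_famSifted, h0, Nat.cast_zero])
  have hgood' : ∀ Q ∈ good, Squarefree (Ideal.absNorm Q) ∧ a ≤ (Ideal.absNorm Q : ℝ) ∧
      (Ideal.absNorm Q : ℝ) < b := by
    intro Q hQ
    rw [hgood, mem_filter, mem_primesNormIco_iff] at hQ
    obtain ⟨⟨-, -, haQ, hQb⟩, hprime⟩ := hQ
    exact ⟨hprime.squarefree, haQ, hQb⟩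
  have hM0 : 0 ≤ η ^ 2 * X ^ 2 := by positivity
  have hErr0 : 0 ≤ X ^ (2 - τ / 5) := (Real.rpow_pos_of_pos hX0 _).le
  have step3 := dyadic_sum_weight_le (S := fun Q => (siftedA X η Q z : ℝ)) hw0 h71A hC hM0 hErr0 hX0 ha2
    hab hb hm1 good hgood'
  have hlog4 : 0 < Real.log (X ^ (1 / 4 : ℝ)) := Real.log_pos hX14
  have hlogm : Real.log (X ^ (1 / 4 : ℝ)) ≤ Real.log (min (X ^ (1 / 2 : ℝ)) (X ^ (2 - τ) / b)) :=
    Real.log_le_log (by linarith) hm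
  have hsum0 : 0 ≤ ∑ Q ∈ good, w Q := sum_nonneg fun Q _ => hw0 Q
  calc (primeRangeSum (boxPairs X η) pairIdeal a b : ℝ)
      ≤ ∑ P ∈ good, (siftedA X η P z : ℝ) := step1.trans step2.le
    _ ≤ C * (η ^ 2 * X ^ 2 / Real.log (min (X ^ (1 / 2 : ℝ)) (X ^ (2 - τ) / b)) * ∑ Q ∈ good, w Q) +
          (Real.log b / Real.log 2 + 1) * (C * X ^ (2 - τ / 5)) := step3
    _ ≤ C * (η ^ 2 * X ^ 2 / Real.log (X ^ (1 / 4 : ℝ)) * ∑ Q ∈ good, w Q) +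
          (Real.log b / Real.log 2 + 1) * (C * X ^ (2 - τ / 5)) := by
        have h1 : η ^ 2 * X ^ 2 / Real.log (min (X ^ (1 / 2 : ℝ)) (X ^ (2 - τ) / b)) ≤
            η ^ 2 * X ^ 2 / Real.log (X ^ (1 / 4 : ℝ)) :=
          div_le_div_of_nonneg_left hM0 hlog4 hlogm
        gcongr
    _ = _ := by ring

/-- **The single-prime pieces `S₃(ℬ)`, `S₅(ℬ)` via Lemma 7.1 with a general weight** (as
`primeRangeSum_normWindow_ideal_le`, weight `w(P)`). [cite: HeathBrownActa2001, §7 p. 41] -/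
theorem primeRangeSum_normWindow_weight_le {X η τ C C_B a b : ℝ} {w : Ideal (𝓞 K) → ℝ}
    (hw0 : ∀ Q, 0 ≤ w Q) (hX : 16 ≤ X) (hC : 0 ≤ C) (hCB : 0 ≤ C_B) (hη0 : 0 ≤ η)
    (ha : X ^ (1 / 2 : ℝ) ≤ a) (hab : a ≤ b) (hb : b ≤ X ^ (2 - 2 * τ))
    (hm : X ^ (1 / 4 : ℝ) ≤ min (X ^ (1 / 2 : ℝ)) (X ^ (2 - τ) / b))
    (h71B : ∀ (N : ℝ) (𝒮 : Finset (Ideal (𝓞 K))), 0 < N → N ≤ X ^ (2 - 2 * τ) →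
        (∀ Q ∈ 𝒮, Squarefree (Ideal.absNorm Q) ∧ N < (Ideal.absNorm Q : ℝ) ∧
          (Ideal.absNorm Q : ℝ) ≤ 2 * N) →
        ∑ Q ∈ 𝒮, (siftedB X η Q (X ^ (1 / 2 : ℝ)) : ℝ) ≤
          C * (η * X ^ 3 / Real.log (min (X ^ (1 / 2 : ℝ)) (X ^ (2 - τ) / N)) *
            ∑ Q ∈ 𝒮, w Q + X ^ (3 - τ / 5)))
    (hcountB : ∀ R : Ideal (𝓞 K), R ≠ ⊥ → (countB X η R : ℝ) ≤ C_B * X ^ 3 / Ideal.absNorm R) :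
    (primeRangeSum (normWindow X η) (fun J => J) a b : ℝ) ≤
      C * (η * X ^ 3 / Real.log (X ^ (1 / 4 : ℝ))) *
          ∑ P ∈ (primesNormIco a b).filter (fun P => (Ideal.absNorm P).Prime), w P +
        (Real.log b / Real.log 2 + 1) * (C * X ^ (3 - τ / 5)) +
        3 * (Real.sqrt b + 1) * (C_B * X ^ 3 / a) := by
  classical
  have hX0 : 0 < X := by linarith
  have hX1 : 1 < X := by linarith
  set z : ℝ := X ^ (1 / 2 : ℝ) with hz
  have hz4 : 4 ≤ z := by
    calc (4 : ℝ) = (16 : ℝ) ^ (1 / 2 : ℝ) := by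
          rw [show (16 : ℝ) = 4 ^ (2 : ℝ) by norm_num, ← Real.rpow_mul (by norm_num)]; norm_num
      _ ≤ X ^ (1 / 2 : ℝ) := Real.rpow_le_rpow (by norm_num) hX (by norm_num)
  have ha2 : 2 ≤ a := by linarith
  have ha0 : 0 < a := by linarith
  have hX14 : 1 < X ^ (1 / 4 : ℝ) := Real.one_lt_rpow hX1 (by norm_num)
  have hm1 : 1 < min (X ^ (1 / 2 : ℝ)) (X ^ (2 - τ) / b) := lt_of_lt_of_le hX14 hm
  set Pset := primesNormIco a b with hPset
  set E := normWindow X η with hE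
  have step1 : (primeRangeSum E (fun J => J) a b : ℝ) ≤
      ∑ P ∈ Pset, (famSifted E (fun J => J) P z : ℝ) := by
    rw [primeRangeSum, Nat.cast_sum]
    refine sum_le_sum fun P hP => ?_
    have hNP : z ≤ Ideal.absNorm P := ha.trans ((mem_primesNormIco_iff.mp hP).2.2.1)
    exact_mod_cast famSiftedAbove_le_famSifted _ _ P P hNP
  set good := Pset.filter fun P => (Ideal.absNorm P).Prime with hgood
  set bad := Pset.filter fun P => ¬ (Ideal.absNorm P).Prime with hbad
  have step2 : ∑ P ∈ Pset, (famSifted E (fun J => J) P z : ℝ) =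
      ∑ P ∈ good, (siftedB X η P z : ℝ) + ∑ P ∈ bad, (famSifted E (fun J => J) P z : ℝ) := by
    rw [hgood, hbad, ← sum_filter_add_sum_filter_not Pset (fun P => (Ideal.absNorm P).Prime)]
    congr 1
    exact sum_congr rfl fun P _ => by rw [hE, siftedB_eq_famSifted]
  have hbad_card : (#bad : ℝ) ≤ 3 * (Real.sqrt b + 1) := by
    have hsub : bad ⊆ (Literature.NumberTheory.LFunctions.NumberField.finite_primeIdealsLE K b).toFinset.filter
        fun P => ¬ (Ideal.absNorm P).Prime := by
      intro P hP
      rw [hbad, mem_filter, mem_primesNormIco_iff] at hP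
      obtain ⟨⟨hPp, hP0, -, hPb⟩, hnp⟩ := hP
      simp only [mem_filter, Set.Finite.mem_toFinset,
        Literature.NumberTheory.LFunctions.NumberField.primeIdealsLE, Set.mem_setOf_eq]
      exact ⟨⟨hPp, hP0, hPb.le⟩, hnp⟩
    calc (#bad : ℝ) ≤ #((Literature.NumberTheory.LFunctions.NumberField.finite_primeIdealsLE K b).toFinset.filter
          fun P => ¬ (Ideal.absNorm P).Prime) := by exact_mod_cast card_le_card hsub
      _ ≤ Module.finrank ℚ K * (Real.sqrt b + 1) := card_filter_not_prime_absNorm_le _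
      _ = 3 * (Real.sqrt b + 1) := by rw [finrank_K]; norm_num
  have step3bad : ∑ P ∈ bad, (famSifted E (fun J => J) P z : ℝ) ≤
      3 * (Real.sqrt b + 1) * (C_B * X ^ 3 / a) := by
    have hterm : ∀ P ∈ bad, (famSifted E (fun J => J) P z : ℝ) ≤ C_B * X ^ 3 / a := by
      intro P hP
      rw [hbad, mem_filter, mem_primesNormIco_iff] at hP
      obtain ⟨⟨hPp, hP0, haP, -⟩, -⟩ := hP
      calc (famSifted E (fun J => J) P z : ℝ) ≤ famCount E (fun J => J) P := by
            exact_mod_cast famSifted_le_famCount E _ P z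
        _ = countB X η P := by rw [hE, famCount_normWindow]
        _ ≤ C_B * X ^ 3 / Ideal.absNorm P := hcountB P hP0
        _ ≤ C_B * X ^ 3 / a := div_le_div_of_nonneg_left (by positivity) ha0 haP
    calc ∑ P ∈ bad, (famSifted E (fun J => J) P z : ℝ) ≤ ∑ P ∈ bad, C_B * X ^ 3 / a :=
          sum_le_sum hterm
      _ = #bad * (C_B * X ^ 3 / a) := by rw [sum_const, nsmul_eq_mul]
      _ ≤ 3 * (Real.sqrt b + 1) * (C_B * X ^ 3 / a) :=
          mul_le_mul_of_nonneg_right hbad_card (by positivity)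
  have hgood' : ∀ Q ∈ good, Squarefree (Ideal.absNorm Q) ∧ a ≤ (Ideal.absNorm Q : ℝ) ∧
      (Ideal.absNorm Q : ℝ) < b := by
    intro Q hQ
    rw [hgood, mem_filter, mem_primesNormIco_iff] at hQ
    obtain ⟨⟨-, -, haQ, hQb⟩, hprime⟩ := hQ
    exact ⟨hprime.squarefree, haQ, hQb⟩
  have hM0 : 0 ≤ η * X ^ 3 := by positivity
  have hErr0 : 0 ≤ X ^ (3 - τ / 5) := (Real.rpow_pos_of_pos hX0 _).le
  have step3 := dyadic_sum_weight_le (S := fun Q => (siftedB X η Q z : ℝ)) hw0 h71B hC hM0 hErr0 hX0 ha2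
    hab hb hm1 good hgood'
  have hlog4 : 0 < Real.log (X ^ (1 / 4 : ℝ)) := Real.log_pos hX14
  have hlogm : Real.log (X ^ (1 / 4 : ℝ)) ≤ Real.log (min (X ^ (1 / 2 : ℝ)) (X ^ (2 - τ) / b)) :=
    Real.log_le_log (by linarith) hm
  have hsum0 : 0 ≤ ∑ Q ∈ good, w Q := sum_nonneg fun Q _ => hw0 Q
  have hmain : ∑ P ∈ good, (siftedB X η P z : ℝ) ≤
      C * (η * X ^ 3 / Real.log (X ^ (1 / 4 : ℝ))) * ∑ Q ∈ good, w Q +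
        (Real.log b / Real.log 2 + 1) * (C * X ^ (3 - τ / 5)) := by
    calc ∑ P ∈ good, (siftedB X η P z : ℝ)
        ≤ C * (η * X ^ 3 / Real.log (min (X ^ (1 / 2 : ℝ)) (X ^ (2 - τ) / b)) * ∑ Q ∈ good, w Q) +
            (Real.log b / Real.log 2 + 1) * (C * X ^ (3 - τ / 5)) := step3
      _ ≤ C * (η * X ^ 3 / Real.log (X ^ (1 / 4 : ℝ)) * ∑ Q ∈ good, w Q) +
            (Real.log b / Real.log 2 + 1) * (C * X ^ (3 - τ / 5)) := by
          have h1 : η * X ^ 3 / Real.log (min (X ^ (1 / 2 : ℝ)) (X ^ (2 - τ) / b)) ≤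
              η * X ^ 3 / Real.log (X ^ (1 / 4 : ℝ)) :=
            div_le_div_of_nonneg_left hM0 hlog4 hlogm
          gcongr
      _ = _ := by ring
  calc (primeRangeSum E (fun J => J) a b : ℝ)
      ≤ ∑ P ∈ good, (siftedB X η P z : ℝ) + ∑ P ∈ bad, (famSifted E (fun J => J) P z : ℝ) :=
        step1.trans step2.le
    _ ≤ (C * (η * X ^ 3 / Real.log (X ^ (1 / 4 : ℝ))) * ∑ Q ∈ good, w Q +
          (Real.log b / Real.log 2 + 1) * (C * X ^ (3 - τ / 5))) +
          3 * (Real.sqrt b + 1) * (C_B * X ^ 3 / a) := add_le_add hmain step3bad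

open scoped Classical in
/-- **The good part of a `U`-piece via Lemma 7.1 with a general weight** (as `sum_good_ideal_le`,
weight `w`). [cite: HeathBrownActa2001, §7 pp. 41–42] -/
theorem sum_good_weight_le {ι : Type*} (E : Finset ι) (I : ι → Ideal (𝓞 K)) {X τ z C M Err a b : ℝ}
    {n : ℕ} {S w : Ideal (𝓞 K) → ℝ} (hw0 : ∀ Q, 0 ≤ w Q) (hS : ∀ R, (famSifted E I R z : ℝ) ≤ S R)
    (h71 : ∀ (N : ℝ) (𝒮 : Finset (Ideal (𝓞 K))), 0 < N → N ≤ X ^ (2 - 2 * τ) →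
        (∀ Q ∈ 𝒮, Squarefree (Ideal.absNorm Q) ∧ N < (Ideal.absNorm Q : ℝ) ∧
          (Ideal.absNorm Q : ℝ) ≤ 2 * N) →
        ∑ Q ∈ 𝒮, S Q ≤ C * (M / Real.log (min z (X ^ (2 - τ) / N)) * ∑ Q ∈ 𝒮, w Q + Err))
    (hC : 0 ≤ C) (hM : 0 ≤ M) (hErr : 0 ≤ Err) (hX : 0 < X) (ha : 2 ≤ a) (hab : a ≤ b)
    (hb : b ≤ X ^ (2 - 2 * τ)) (hm : 1 < min z (X ^ (2 - τ) / b))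
    (T : Finset (Finset (Ideal (𝓞 K)) × Ideal (𝓞 K))) (hT : T ⊆ Upairs X τ n)
    (hz : ∀ t ∈ T, z ≤ Ideal.absNorm t.2)
    (hrange : ∀ t ∈ T, UGood t →
      a ≤ (Ideal.absNorm (uIdeal t) : ℝ) ∧ (Ideal.absNorm (uIdeal t) : ℝ) < b) :
    ∑ t ∈ T.filter UGood, (famSiftedAbove E I (uIdeal t) t.2 : ℝ) ≤
      C * (M / Real.log (min z (X ^ (2 - τ) / b)) * ∑ t ∈ T.filter UGood, w (uIdeal t)) +
        (Real.log b / Real.log 2 + 1) * (C * Err) := by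
  classical
  set Tg := T.filter UGood with hTg
  have hTgU : ∀ t ∈ Tg, t ∈ Upairs X τ n := fun t ht => hT (mem_filter.mp ht).1
  have step1 : ∑ t ∈ Tg, (famSiftedAbove E I (uIdeal t) t.2 : ℝ) ≤ ∑ t ∈ Tg, S (uIdeal t) := by
    refine sum_le_sum fun t ht => ?_
    have ht' := (mem_filter.mp ht).1
    calc (famSiftedAbove E I (uIdeal t) t.2 : ℝ) ≤ famSifted E I (uIdeal t) z := by
          exact_mod_cast famSiftedAbove_le_famSifted E I _ _ (hz t ht')
      _ ≤ S (uIdeal t) := hS _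
  set 𝒮 := Tg.image uIdeal with h𝒮def
  have hinj : Set.InjOn uIdeal (Tg : Set _) := (uIdeal_injOn X τ n).mono fun t ht => hTgU t ht
  have step2 : ∑ t ∈ Tg, S (uIdeal t) = ∑ Q ∈ 𝒮, S Q := by
    rw [h𝒮def, sum_image (g := uIdeal) (f := S) hinj]
  have hrecip : ∑ Q ∈ 𝒮, w Q = ∑ t ∈ Tg, w (uIdeal t) := by
    rw [h𝒮def, sum_image (g := uIdeal) (f := w) hinj]
  have h𝒮 : ∀ Q ∈ 𝒮, Squarefree (Ideal.absNorm Q) ∧ a ≤ (Ideal.absNorm Q : ℝ) ∧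
      (Ideal.absNorm Q : ℝ) < b := by
    intro Q hQ
    obtain ⟨t, ht, rfl⟩ := mem_image.mp hQ
    obtain ⟨htT, hg⟩ := mem_filter.mp ht
    exact ⟨squarefree_absNorm_uIdeal (snd_notMem_fst (hT htT)) hg, hrange t htT hg⟩
  have step3 := dyadic_sum_weight_le hw0 h71 hC hM hErr hX ha hab hb hm 𝒮 h𝒮
  rw [hrecip] at step3
  calc ∑ t ∈ Tg, (famSiftedAbove E I (uIdeal t) t.2 : ℝ) ≤ ∑ Q ∈ 𝒮, S Q := step1.trans step2.le
    _ ≤ _ := step3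

/-! ### From the corrected Lemma 7.1 to the weighted form; the weight `c_K(N(Q))/N(Q)` -/

/-- The number of ideals with a given norm `q ∈ 𝒬` inside `normIn 𝒬` is `c_K(q)`
(`Literature.NumberTheory.LFunctions.idealNormCount`). [folklore] -/
theorem card_filter_normIn_absNorm_eq {𝒬 : Finset ℕ} {q : ℕ} (hq : q ∈ 𝒬) :
    #((normIn 𝒬).filter fun Q => Ideal.absNorm Q = q) = idealNormCount K q := by
  classical
  rw [idealNormCount_def, ← Nat.card_eq_finsetCard]
  refine Nat.card_congr (Equiv.subtypeEquivRight fun Q => ?_)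
  simp only [mem_filter, mem_normIn_iff, and_iff_right_iff_imp]
  intro h
  rwa [h]

/-- **Sub-families from the corrected Lemma 7.1.** If a non-negative function `S` of ideals satisfies
the conclusion of the corrected Lemma 7.1 on the printed ranges (all ideals whose norm lies in a set
`𝒬` of square-free integers in `(N, 2N]`, weight `∑_{N(Q)∈𝒬} N(Q)^{-1}`), then for every finite set `𝒮`
of ideals with square-free norms in `(N, 2N]`,
`∑_{Q∈𝒮} S(Q) ≤ C (M/log min(z, X^{2−τ}/N) · ∑_{Q∈𝒮} c_K(N(Q))/N(Q) + Err)` — enlarge `𝒮` to all ideals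
of the norms it meets (non-negativity) and count the ideals of each such norm (`c_K(q)` of them, each
of weight `q^{-1}`). [cite: HeathBrownActa2001, Lemma 7.1] -/
theorem weightForm_of_normWeighted {X τ z C M Err : ℝ} {S : Ideal (𝓞 K) → ℝ}
    (hS0 : ∀ Q, 0 ≤ S Q) (hC : 0 ≤ C) (hM : 0 ≤ M)
    (hlog : ∀ N : ℝ, 0 < N → N ≤ X ^ (2 - 2 * τ) → 1 ≤ min z (X ^ (2 - τ) / N))
    (hN : ∀ (N : ℝ) (𝒬 : Finset ℕ), 0 < N → N ≤ X ^ (2 - 2 * τ) →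
        (∀ q ∈ 𝒬, Squarefree q ∧ N < q ∧ (q : ℝ) ≤ 2 * N) →
        ∑ Q ∈ normIn 𝒬, S Q ≤
          C * (M / Real.log (min z (X ^ (2 - τ) / N)) * ∑ Q ∈ normIn 𝒬, ((Ideal.absNorm Q : ℕ) : ℝ)⁻¹ + Err))
    (N : ℝ) (𝒮 : Finset (Ideal (𝓞 K))) (hNpos : 0 < N) (hNX : N ≤ X ^ (2 - 2 * τ))
    (h𝒮 : ∀ Q ∈ 𝒮, Squarefree (Ideal.absNorm Q) ∧ N < (Ideal.absNorm Q : ℝ) ∧ (Ideal.absNorm Q : ℝ) ≤ 2 * N) :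
    ∑ Q ∈ 𝒮, S Q ≤ C * (M / Real.log (min z (X ^ (2 - τ) / N)) *
      ∑ Q ∈ 𝒮, (idealNormCount K (Ideal.absNorm Q) : ℝ) * ((Ideal.absNorm Q : ℕ) : ℝ)⁻¹ + Err) := by
  classical
  set 𝒬 := 𝒮.image Ideal.absNorm with h𝒬
  have h𝒬mem : ∀ q ∈ 𝒬, Squarefree q ∧ N < q ∧ (q : ℝ) ≤ 2 * N := by
    intro q hq
    obtain ⟨Q, hQ, rfl⟩ := mem_image.mp hq
    exact h𝒮 Q hQ
  have hsub : 𝒮 ⊆ normIn 𝒬 := fun Q hQ => mem_normIn_iff.mpr (mem_image_of_mem _ hQ)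
  have h1 : ∑ Q ∈ 𝒮, S Q ≤ ∑ Q ∈ normIn 𝒬, S Q :=
    sum_le_sum_of_subset_of_nonneg hsub fun Q _ _ => hS0 Q
  have h2 := hN N 𝒬 hNpos hNX h𝒬mem
  -- the weight over all ideals of the norms in `𝒬`
  have hweight : ∑ Q ∈ normIn 𝒬, ((Ideal.absNorm Q : ℕ) : ℝ)⁻¹ ≤
      ∑ Q ∈ 𝒮, (idealNormCount K (Ideal.absNorm Q) : ℝ) * ((Ideal.absNorm Q : ℕ) : ℝ)⁻¹ := by
    rw [← sum_fiberwise_of_maps_to (s := normIn 𝒬) (t := 𝒬) (g := Ideal.absNorm)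
      (fun Q hQ => mem_normIn_iff.mp hQ)]
    have hfib : ∀ q ∈ 𝒬, ∑ Q ∈ (normIn 𝒬).filter (fun Q => Ideal.absNorm Q = q),
        ((Ideal.absNorm Q : ℕ) : ℝ)⁻¹ = (idealNormCount K q : ℝ) * (q : ℝ)⁻¹ := by
      intro q hq
      rw [sum_congr rfl (fun Q hQ => by rw [(mem_filter.mp hQ).2] :
        ∀ Q ∈ (normIn 𝒬).filter (fun Q => Ideal.absNorm Q = q), ((Ideal.absNorm Q : ℕ) : ℝ)⁻¹ = (q : ℝ)⁻¹),
        sum_const, nsmul_eq_mul, card_filter_normIn_absNorm_eq hq]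
    rw [sum_congr rfl hfib, h𝒬]
    exact sum_image_le_of_nonneg fun q _ => by positivity
  have hMl : 0 ≤ M / Real.log (min z (X ^ (2 - τ) / N)) :=
    div_nonneg hM (Real.log_nonneg (hlog N hNpos hNX))
  calc ∑ Q ∈ 𝒮, S Q ≤ ∑ Q ∈ normIn 𝒬, S Q := h1
    _ ≤ C * (M / Real.log (min z (X ^ (2 - τ) / N)) * ∑ Q ∈ normIn 𝒬, ((Ideal.absNorm Q : ℕ) : ℝ)⁻¹ + Err) := h2
    _ ≤ _ := by gcongr

/-- `c_K` of a product of pairwise distinct rational primes (as norms of prime ideals of prime norm)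
is at most `8^k`: `c_K` is multiplicative on coprime arguments and `c_K(p) ≤ 2^{[K:ℚ]} = 8`.
[folklore] -/
theorem idealNormCount_prod_absNorm_le (s : Finset (Ideal (𝓞 K)))
    (hpr : ∀ P ∈ s, (Ideal.absNorm P).Prime)
    (hinj : Set.InjOn Ideal.absNorm (s : Set (Ideal (𝓞 K)))) :
    (idealNormCount K (∏ P ∈ s, Ideal.absNorm P) : ℝ) ≤ 8 ^ #s := by
  classical
  induction s using Finset.induction_on with
  | empty => simp [idealNormCount_one]
  | insert P₀ s hP₀ ih =>
    have hpr' : ∀ P ∈ s, (Ideal.absNorm P).Prime := fun P hP => hpr P (mem_insert_of_mem hP)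
    have hinj' : Set.InjOn Ideal.absNorm (s : Set (Ideal (𝓞 K))) :=
      hinj.mono (by simp [Set.subset_insert])
    have hp₀ : (Ideal.absNorm P₀).Prime := hpr P₀ (mem_insert_self _ _)
    have hcop : (Ideal.absNorm P₀).Coprime (∏ P ∈ s, Ideal.absNorm P) := by
      refine Nat.Coprime.prod_right fun P hP => ?_
      rw [Nat.coprime_primes hp₀ (hpr' P hP)]
      intro h
      have : P₀ = P := hinj (mem_insert_self _ _) (mem_insert_of_mem hP) h
      exact hP₀ (this ▸ hP)
    rw [prod_insert hP₀, idealNormCount_mul_of_coprime K hcop,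
      Nat.cast_mul, card_insert_of_notMem hP₀, pow_succ']
    refine mul_le_mul ?_ (ih hpr' hinj') (by positivity) (by norm_num)
    have h := idealNormCount_prime_le K hp₀
    rw [finrank_K] at h
    norm_num at h
    exact_mod_cast h

/-- The weight `c_K(N(P))/N(P) ≤ 8/N(P)` at a prime ideal of prime norm. [folklore] -/
theorem normWeight_prime_le {P : Ideal (𝓞 K)} (hp : (Ideal.absNorm P).Prime) :
    (idealNormCount K (Ideal.absNorm P) : ℝ) * ((Ideal.absNorm P : ℕ) : ℝ)⁻¹ ≤
      8 * ((Ideal.absNorm P : ℕ) : ℝ)⁻¹ := by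
  refine mul_le_mul_of_nonneg_right ?_ (by positivity)
  have h := idealNormCount_prime_le K hp
  rw [finrank_K] at h
  norm_num at h
  exact_mod_cast h

/-- The weight `c_K(N(P_1⋯P_{n+1}))/N(P_1⋯P_{n+1}) ≤ 8^{n+1}/N(P_1⋯P_{n+1})` at a good index of
`U^(n)` (all `N(P_i)` prime and distinct). [folklore] -/
theorem normWeight_uIdeal_le {X τ : ℝ} {n : ℕ} {t : Finset (Ideal (𝓞 K)) × Ideal (𝓞 K)}
    (ht : t ∈ Upairs X τ n) (hg : UGood t) :
    (idealNormCount K (Ideal.absNorm (uIdeal t)) : ℝ) * ((Ideal.absNorm (uIdeal t) : ℕ) : ℝ)⁻¹ ≤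
      8 ^ (n + 1) * ((Ideal.absNorm (uIdeal t) : ℕ) : ℝ)⁻¹ := by
  classical
  refine mul_le_mul_of_nonneg_right ?_ (by positivity)
  have hnot := snd_notMem_fst ht
  have hcard : #(insert t.2 t.1) = n + 1 := by
    rw [card_insert_of_notMem hnot, (mem_chains_iff.mp (mem_Upairs_iff.mp ht).1).2.1]
  rw [uIdeal_eq_prod_insert hnot, absNorm_prod, ← hcard]
  exact idealNormCount_prod_absNorm_le _ hg.1 hg.2

/-! ### The single-prime pieces `S₃`, `S₅` (p. 41) -/

/-- **`S_j(𝒜) + κS_j(ℬ) ≪ τη²X²/log X` for the single-prime pieces** (`j = 3, 5`; p. 41), from the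
ideal-weighted Lemma 7.1 at level `X^{1/2}` for both families (`h7A`, `h7B`), the crude count
`#ℬ^(K)_R ≤ C_ℬX³/N(R)` for the prime ideals of degree `≥ 2`, and a window bound
`3(log(2b/a) + K₁)/log(a/2) ≤ W_c τ` for the first-degree primes of the range `[a, b)` (Mertens):
explicitly, `≤ (4C₇W_c + 3C₇ + (4/3)σ₀C₇W_c + σ₀C₇ + 3σ₀C_ℬ) · τη²X²/log X`.
[cite: HeathBrownActa2001, §7 p. 41] -/
theorem primeRange_piece_le {X η τ σ₀ C₇ C_B K₁ Wc a b : ℝ} {w : Ideal (𝓞 K) → ℝ}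
    (hX : (2 : ℝ) ^ 15 ≤ X) (hτ8 : τ ≤ 1 / 8) (hη0 : 0 < η) (hη1 : η ≤ 1)
    (hσ0 : 0 ≤ σ₀) (hC₇ : 0 ≤ C₇) (hCB : 0 ≤ C_B)
    (habs : X ^ (-τ / 5) * Real.log X ^ 3 ≤ τ * η ^ 2 / Real.log X)
    (hK : ∀ (lo hi : ℝ) (T : Finset ℕ), 2 ≤ lo → lo ≤ hi →
      (∀ p ∈ T, p.Prime ∧ lo < (p : ℝ) ∧ (p : ℝ) ≤ hi) →
      ∑ p ∈ T, (p : ℝ)⁻¹ ≤ (Real.log (hi / lo) + K₁) / Real.log lo)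
    (hw0 : ∀ Q, 0 ≤ w Q)
    (hwP : ∀ P : Ideal (𝓞 K), (Ideal.absNorm P).Prime → w P ≤ 8 * ((Ideal.absNorm P : ℕ) : ℝ)⁻¹)
    (h7A : ∀ (N z : ℝ) (𝒮 : Finset (Ideal (𝓞 K))), X ^ τ ≤ z → 0 < N → N ≤ X ^ (2 - 2 * τ) →
        (∀ Q ∈ 𝒮, Squarefree (Ideal.absNorm Q) ∧ N < (Ideal.absNorm Q : ℝ) ∧
          (Ideal.absNorm Q : ℝ) ≤ 2 * N) →
        ∑ Q ∈ 𝒮, (siftedA X η Q z : ℝ) ≤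
          C₇ * (η ^ 2 * X ^ 2 / Real.log (min z (X ^ (2 - τ) / N)) * ∑ Q ∈ 𝒮, w Q + X ^ (2 - τ / 5)))
    (h7B : ∀ (N z : ℝ) (𝒮 : Finset (Ideal (𝓞 K))), X ^ τ ≤ z → 0 < N → N ≤ X ^ (2 - 2 * τ) →
        (∀ Q ∈ 𝒮, Squarefree (Ideal.absNorm Q) ∧ N < (Ideal.absNorm Q : ℝ) ∧
          (Ideal.absNorm Q : ℝ) ≤ 2 * N) →
        ∑ Q ∈ 𝒮, (siftedB X η Q z : ℝ) ≤
          C₇ * (η * X ^ 3 / Real.log (min z (X ^ (2 - τ) / N)) * ∑ Q ∈ 𝒮, w Q + X ^ (3 - τ / 5)))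
    (hcountB : ∀ R : Ideal (𝓞 K), R ≠ ⊥ → (countB X η R : ℝ) ≤ C_B * X ^ 3 / Ideal.absNorm R)
    (hXa : X ^ (1 / 2 : ℝ) ≤ a) (hab : a ≤ b) (hbτ : b ≤ X ^ (2 - 2 * τ)) (hb2 : b ≤ X ^ 2)
    (hm : X ^ (1 / 4 : ℝ) ≤ min (X ^ (1 / 2 : ℝ)) (X ^ (2 - τ) / b))
    (hwin : 3 * ((Real.log (b / (a / 2)) + K₁) / Real.log (a / 2)) ≤ Wc * τ)
    (hbad : (Real.sqrt b + 1) / a ≤ 3 * X ^ (-(1 / 4 : ℝ))) :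
    (primeRangeSum (boxPairs X η) pairIdeal a b : ℝ) +
        kappa σ₀ X η * primeRangeSum (normWindow X η) (fun J => J) a b ≤
      (32 * C₇ * Wc + 3 * C₇ + 32 / 3 * σ₀ * C₇ * Wc + σ₀ * C₇ + 3 * σ₀ * C_B) *
        (τ * η ^ 2 * X ^ 2 / Real.log X) := by
  classical
  set L := Real.log X with hL
  have hX16 : 16 ≤ X := le_trans (by norm_num) hX
  have hX1 : 1 ≤ X := by linarith
  have hX0 : 0 < X := by linarith
  have hL10 : 10 ≤ L := ten_le_log hX
  have hL1 : 1 ≤ L := by linarith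
  have hL0 : 0 < L := by linarith
  have hτ : X ^ τ ≤ X ^ (1 / 2 : ℝ) := Real.rpow_le_rpow_of_exponent_le hX1 (by linarith)
  have hz4 : 4 ≤ X ^ (1 / 2 : ℝ) := by
    calc (4 : ℝ) = (16 : ℝ) ^ (1 / 2 : ℝ) := by
          rw [show (16 : ℝ) = 4 ^ (2 : ℝ) by norm_num, ← Real.rpow_mul (by norm_num)]; norm_num
      _ ≤ X ^ (1 / 2 : ℝ) := Real.rpow_le_rpow (by norm_num) hX16 (by norm_num)
  have ha4 : 4 ≤ a := hz4.trans hXa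
  have ha0 : 0 < a := by linarith
  have hlog4 : Real.log (X ^ (1 / 4 : ℝ)) = L / 4 := by rw [Real.log_rpow hX0]; ring
  set B₀ := τ * η ^ 2 * X ^ 2 / L with hB₀
  -- the window sum over the first-degree primes of the range
  set good := (primesNormIco a b).filter (fun P => (Ideal.absNorm P).Prime) with hgood
  have hSum' : ∑ P ∈ good, ((Ideal.absNorm P : ℕ) : ℝ)⁻¹ ≤ Wc * τ := by
    refine (sum_inv_absNorm_window_le hK (lo := a / 2) (hi := b) (by linarith) (by linarith) good
      fun P hP => ?_).trans hwin
    rw [hgood, mem_filter, mem_primesNormIco_iff] at hP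
    obtain ⟨⟨hPp, hP0, haP, hPb⟩, hpr⟩ := hP
    exact ⟨hPp, hP0, hpr, by linarith, hPb.le⟩
  have hSum : ∑ P ∈ good, w P ≤ 8 * (Wc * τ) := by
    calc ∑ P ∈ good, w P ≤ ∑ P ∈ good, 8 * ((Ideal.absNorm P : ℕ) : ℝ)⁻¹ :=
          sum_le_sum fun P hP => hwP P (mem_filter.mp hP).2
      _ = 8 * ∑ P ∈ good, ((Ideal.absNorm P : ℕ) : ℝ)⁻¹ := by rw [mul_sum]
      _ ≤ 8 * (Wc * τ) := by gcongr
  have hSum0 : 0 ≤ ∑ P ∈ good, w P := sum_nonneg fun _ _ => hw0 _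
  have hlb : Real.log b / Real.log 2 + 1 ≤ 3 * L :=
    log_div_log_two_add_one_le (by linarith) hb2 hL hL10
  -- the `𝒜`-piece
  have hA := primeRangeSum_boxPairs_weight_le (η := η) hw0 hX16 hC₇ hXa hab hbτ hm
    (fun N 𝒮 hN hNX hmem => h7A N _ 𝒮 hτ hN hNX hmem)
  have hA1 : C₇ * (η ^ 2 * X ^ 2 / Real.log (X ^ (1 / 4 : ℝ))) *
      ∑ P ∈ good, w P ≤ 32 * C₇ * Wc * B₀ := by
    rw [hlog4]
    calc C₇ * (η ^ 2 * X ^ 2 / (L / 4)) * ∑ P ∈ good, w P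
        ≤ C₇ * (η ^ 2 * X ^ 2 / (L / 4)) * (8 * (Wc * τ)) := by gcongr
      _ = 32 * C₇ * Wc * B₀ := by rw [hB₀]; field_simp; ring
  have hA2 : (Real.log b / Real.log 2 + 1) * (C₇ * X ^ (2 - τ / 5)) ≤ 3 * C₇ * B₀ := by
    have hXp : 0 ≤ X ^ (2 - τ / 5) := by positivity
    calc (Real.log b / Real.log 2 + 1) * (C₇ * X ^ (2 - τ / 5)) ≤ 3 * L * (C₇ * X ^ (2 - τ / 5)) := by
          gcongr
      _ = 3 * C₇ * (X ^ 2 * X ^ (-(τ / 5)) * L ^ 1) := by rw [rpow_two_sub hX0]; ring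
      _ ≤ 3 * C₇ * B₀ := by
          rw [hB₀]
          exact absorb_le hX1 hL1 (by positivity) le_rfl (by norm_num) habs
  -- the `ℬ`-piece
  have hB := primeRangeSum_normWindow_weight_le (η := η) hw0 hX16 hC₇ hCB hη0.le hXa hab hbτ hm
    (fun N 𝒮 hN hNX hmem => h7B N _ 𝒮 hτ hN hNX hmem) hcountB
  set κ := kappa σ₀ X η with hκ
  have hκ0 : 0 ≤ κ := by rw [hκ, kappa]; positivity
  have hκeq : κ = σ₀ * η / (3 * X) := rfl
  have hB1 : κ * (C₇ * (η * X ^ 3 / Real.log (X ^ (1 / 4 : ℝ))) *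
      ∑ P ∈ good, w P) ≤ 32 / 3 * σ₀ * C₇ * Wc * B₀ := by
    rw [hlog4]
    calc κ * (C₇ * (η * X ^ 3 / (L / 4)) * ∑ P ∈ good, w P)
        ≤ κ * (C₇ * (η * X ^ 3 / (L / 4)) * (8 * (Wc * τ))) := by gcongr
      _ = 32 / 3 * σ₀ * C₇ * Wc * B₀ := by rw [hB₀, hκeq]; field_simp; ring
  have hB2 : κ * ((Real.log b / Real.log 2 + 1) * (C₇ * X ^ (3 - τ / 5))) ≤ σ₀ * C₇ * B₀ := by
    have hXp : 0 ≤ X ^ (3 - τ / 5) := by positivity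
    calc κ * ((Real.log b / Real.log 2 + 1) * (C₇ * X ^ (3 - τ / 5)))
        ≤ κ * (3 * L * (C₇ * X ^ (3 - τ / 5))) := by gcongr
      _ = σ₀ * C₇ * η * (X ^ 2 * X ^ (-(τ / 5)) * L ^ 1) := by
          rw [rpow_three_sub hX0, hκeq]; field_simp
      _ ≤ σ₀ * C₇ * 1 * (X ^ 2 * X ^ (-(τ / 5)) * L ^ 1) := by gcongr
      _ ≤ σ₀ * C₇ * 1 * B₀ := by
          rw [hB₀]
          exact absorb_le hX1 hL1 (by positivity) le_rfl (by norm_num) habs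
      _ = σ₀ * C₇ * B₀ := by ring
  have hB3 : κ * (3 * (Real.sqrt b + 1) * (C_B * X ^ 3 / a)) ≤ 3 * σ₀ * C_B * B₀ := by
    calc κ * (3 * (Real.sqrt b + 1) * (C_B * X ^ 3 / a))
        = σ₀ * C_B * η * X ^ 2 * ((Real.sqrt b + 1) / a) := by rw [hκeq]; field_simp
      _ ≤ σ₀ * C_B * 1 * X ^ 2 * (3 * X ^ (-(1 / 4 : ℝ))) := by gcongr
      _ = 3 * σ₀ * C_B * (X ^ 2 * X ^ (-(1 / 4 : ℝ)) * L ^ 0) := by ring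
      _ ≤ 3 * σ₀ * C_B * B₀ := by
          rw [hB₀]
          exact absorb_le hX1 hL1 (by positivity) (by linarith) (by norm_num)
            habs
  have hBtot : κ * (primeRangeSum (normWindow X η) (fun J => J) a b : ℝ) ≤
      32 / 3 * σ₀ * C₇ * Wc * B₀ + σ₀ * C₇ * B₀ + 3 * σ₀ * C_B * B₀ := by
    calc κ * (primeRangeSum (normWindow X η) (fun J => J) a b : ℝ)
        ≤ κ * (C₇ * (η * X ^ 3 / Real.log (X ^ (1 / 4 : ℝ))) * ∑ P ∈ good, w P +
            (Real.log b / Real.log 2 + 1) * (C₇ * X ^ (3 - τ / 5)) +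
            3 * (Real.sqrt b + 1) * (C_B * X ^ 3 / a)) := mul_le_mul_of_nonneg_left hB hκ0
      _ = κ * (C₇ * (η * X ^ 3 / Real.log (X ^ (1 / 4 : ℝ))) * ∑ P ∈ good, w P) +
            κ * ((Real.log b / Real.log 2 + 1) * (C₇ * X ^ (3 - τ / 5))) +
            κ * (3 * (Real.sqrt b + 1) * (C_B * X ^ 3 / a)) := by ring
      _ ≤ _ := add_le_add (add_le_add hB1 hB2) hB3
  calc (primeRangeSum (boxPairs X η) pairIdeal a b : ℝ) +
        κ * primeRangeSum (normWindow X η) (fun J => J) a b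
      ≤ (32 * C₇ * Wc * B₀ + 3 * C₇ * B₀) +
          (32 / 3 * σ₀ * C₇ * Wc * B₀ + σ₀ * C₇ * B₀ + 3 * σ₀ * C_B * B₀) :=
        add_le_add (hA.trans (add_le_add hA1 hA2)) hBtot
    _ = _ := by ring

/-! ### The `U`-pieces `S₆`, `S₇`: analytic bookkeeping (p. 41) -/

open scoped Classical in
/-- **A `U`-piece of `𝒜` plus `κ` times the same piece of `ℬ` is `≪ τη²X²/log X`**, given: the
ideal-weighted Lemma 7.1 for both families (`h7A`, `h7B`) at a level `z ≥ X^τ` below every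
`N(P_{n+1})`, a range `[a, b)` for `N(P_1⋯P_{n+1})` with `b ≤ X^{2−2τ}` and
`min(z, X^{2−τ}/b) ≥ X^{c_m}`, a bound `W_c τ` for the reciprocal sum over the good indices and a
bound `W_b (log X)² X^{−1/15}` for the reciprocal sum over the defective indices (which only matter
for `ℬ`, through `#ℬ^(K)_R ≤ C_ℬX³/N(R)`). This is the common analytic bookkeeping of the treatment of
`S₆` and `S₇` on pp. 41–42. [cite: HeathBrownActa2001, §7 pp. 41–42] -/
theorem uPiece_pair_le {X η τ σ₀ C₇ C_B Wc Wb cm mU z a b : ℝ} {n : ℕ} {w : Ideal (𝓞 K) → ℝ}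
    (hX : (2 : ℝ) ^ 15 ≤ X) (hη0 : 0 < η) (hη1 : η ≤ 1)
    (hσ0 : 0 ≤ σ₀) (hC₇ : 0 ≤ C₇) (hCB : 0 ≤ C_B) (hWb : 0 ≤ Wb) (hmU : 0 ≤ mU)
    (hcm0 : 0 < cm) (hτ15 : τ ≤ 1 / 3)
    (habs : X ^ (-τ / 5) * Real.log X ^ 3 ≤ τ * η ^ 2 / Real.log X)
    (hw0 : ∀ Q, 0 ≤ w Q)
    (h7A : ∀ (N z : ℝ) (𝒮 : Finset (Ideal (𝓞 K))), X ^ τ ≤ z → 0 < N → N ≤ X ^ (2 - 2 * τ) →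
        (∀ Q ∈ 𝒮, Squarefree (Ideal.absNorm Q) ∧ N < (Ideal.absNorm Q : ℝ) ∧
          (Ideal.absNorm Q : ℝ) ≤ 2 * N) →
        ∑ Q ∈ 𝒮, (siftedA X η Q z : ℝ) ≤
          C₇ * (η ^ 2 * X ^ 2 / Real.log (min z (X ^ (2 - τ) / N)) * ∑ Q ∈ 𝒮, w Q + X ^ (2 - τ / 5)))
    (h7B : ∀ (N z : ℝ) (𝒮 : Finset (Ideal (𝓞 K))), X ^ τ ≤ z → 0 < N → N ≤ X ^ (2 - 2 * τ) →
        (∀ Q ∈ 𝒮, Squarefree (Ideal.absNorm Q) ∧ N < (Ideal.absNorm Q : ℝ) ∧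
          (Ideal.absNorm Q : ℝ) ≤ 2 * N) →
        ∑ Q ∈ 𝒮, (siftedB X η Q z : ℝ) ≤
          C₇ * (η * X ^ 3 / Real.log (min z (X ^ (2 - τ) / N)) * ∑ Q ∈ 𝒮, w Q + X ^ (3 - τ / 5)))
    (hcountB : ∀ R : Ideal (𝓞 K), R ≠ ⊥ → (countB X η R : ℝ) ≤ C_B * X ^ 3 / Ideal.absNorm R)
    (T : Finset (Finset (Ideal (𝓞 K)) × Ideal (𝓞 K))) (hT : T ⊆ Upairs X τ n)
    (hwU : ∀ t ∈ T, UGood t → w (uIdeal t) ≤ mU * ((Ideal.absNorm (uIdeal t) : ℕ) : ℝ)⁻¹)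
    (hzτ : X ^ τ ≤ z) (hz : ∀ t ∈ T, z ≤ Ideal.absNorm t.2)
    (ha2 : 2 ≤ a) (hab : a ≤ b) (hb : b ≤ X ^ (2 - 2 * τ)) (hb2 : b ≤ X ^ 2)
    (hmin : X ^ cm ≤ min z (X ^ (2 - τ) / b))
    (hrange : ∀ t ∈ T, a ≤ (Ideal.absNorm (uIdeal t) : ℝ) ∧ (Ideal.absNorm (uIdeal t) : ℝ) < b)
    (hgood : ∑ t ∈ T.filter UGood, ((Ideal.absNorm (uIdeal t) : ℕ) : ℝ)⁻¹ ≤ Wc * τ)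
    (hbad : ∑ t ∈ T.filter (fun t => ¬ UGood t), ((Ideal.absNorm (uIdeal t) : ℕ) : ℝ)⁻¹ ≤
      Wb * Real.log X ^ 2 * X ^ (-(1 / 15 : ℝ))) :
    ∑ t ∈ T, (famSiftedAbove (boxPairs X η) pairIdeal (uIdeal t) t.2 : ℝ) +
        kappa σ₀ X η * ∑ t ∈ T, (famSiftedAbove (normWindow X η) (fun J => J) (uIdeal t) t.2 : ℝ) ≤
      (C₇ * mU * Wc / cm + 3 * C₇ + σ₀ * C₇ * mU * Wc / (3 * cm) + σ₀ * C₇ + σ₀ * C_B * Wb / 3) *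
        (τ * η ^ 2 * X ^ 2 / Real.log X) := by
  classical
  set L := Real.log X with hL
  have hX16 : 16 ≤ X := le_trans (by norm_num) hX
  have hX1 : 1 ≤ X := by linarith
  have hX0 : 0 < X := by linarith
  have hL10 : 10 ≤ L := ten_le_log hX
  have hL1 : 1 ≤ L := by linarith
  have hL0 : 0 < L := by linarith
  set B₀ := τ * η ^ 2 * X ^ 2 / L with hB₀
  -- the minimum and its logarithm
  have hXcm : 1 < X ^ cm := Real.one_lt_rpow (by linarith) hcm0
  have hm1 : 1 < min z (X ^ (2 - τ) / b) := lt_of_lt_of_le hXcm hmin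
  have hlogmin : cm * L ≤ Real.log (min z (X ^ (2 - τ) / b)) := by
    calc cm * L = Real.log (X ^ cm) := by rw [Real.log_rpow hX0]
      _ ≤ _ := Real.log_le_log (by positivity) hmin
  have hcmL : 0 < cm * L := by positivity
  have hb1 : 1 ≤ b := by linarith
  have hlb : Real.log b / Real.log 2 + 1 ≤ 3 * L := log_div_log_two_add_one_le hb1 hb2 hL hL10
  have hrange' : ∀ t ∈ T, UGood t →
      a ≤ (Ideal.absNorm (uIdeal t) : ℝ) ∧ (Ideal.absNorm (uIdeal t) : ℝ) < b := fun t ht _ => hrange t ht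
  have hgoodw : ∑ t ∈ T.filter UGood, w (uIdeal t) ≤ mU * (Wc * τ) := by
    calc ∑ t ∈ T.filter UGood, w (uIdeal t)
        ≤ ∑ t ∈ T.filter UGood, mU * ((Ideal.absNorm (uIdeal t) : ℕ) : ℝ)⁻¹ :=
          sum_le_sum fun t ht => hwU t (mem_filter.mp ht).1 (mem_filter.mp ht).2
      _ = mU * ∑ t ∈ T.filter UGood, ((Ideal.absNorm (uIdeal t) : ℕ) : ℝ)⁻¹ := by rw [mul_sum]
      _ ≤ mU * (Wc * τ) := by gcongr
  have hgood0 : 0 ≤ ∑ t ∈ T.filter UGood, w (uIdeal t) := sum_nonneg fun _ _ => hw0 _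
  -- the `𝒜`-piece: only good indices, then Lemma 7.1
  have hA := sum_good_weight_le (boxPairs X η) pairIdeal (S := fun R => (siftedA X η R z : ℝ)) hw0
    (fun R => by rw [siftedA_eq_famSifted]) (fun N 𝒮 hN hNX hmem => h7A N z 𝒮 hzτ hN hNX hmem)
    hC₇ (by positivity) (by positivity) hX0 ha2 hab hb hm1 T hT hz hrange'
  rw [sum_filter_UGood_boxPairs T hT] at hA
  have hA1 : C₇ * (η ^ 2 * X ^ 2 / Real.log (min z (X ^ (2 - τ) / b)) *
      ∑ t ∈ T.filter UGood, w (uIdeal t)) ≤ C₇ * mU * Wc / cm * B₀ := by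
    calc C₇ * (η ^ 2 * X ^ 2 / Real.log (min z (X ^ (2 - τ) / b)) *
          ∑ t ∈ T.filter UGood, w (uIdeal t))
        ≤ C₇ * (η ^ 2 * X ^ 2 / (cm * L) * (mU * (Wc * τ))) := by
          gcongr
      _ = C₇ * mU * Wc / cm * B₀ := by rw [hB₀]; field_simp
  have hA2 : (Real.log b / Real.log 2 + 1) * (C₇ * X ^ (2 - τ / 5)) ≤ 3 * C₇ * B₀ := by
    have hXp : 0 ≤ X ^ (2 - τ / 5) := by positivity
    calc (Real.log b / Real.log 2 + 1) * (C₇ * X ^ (2 - τ / 5)) ≤ 3 * L * (C₇ * X ^ (2 - τ / 5)) := by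
          gcongr
      _ = 3 * C₇ * (X ^ 2 * X ^ (-(τ / 5)) * L ^ 1) := by rw [rpow_two_sub hX0]; ring
      _ ≤ 3 * C₇ * B₀ := by
          rw [hB₀]; exact absorb_le hX1 hL1 (by positivity) le_rfl (by norm_num) habs
  -- the `ℬ`-piece: good indices by Lemma 7.1, bad ones crudely
  set κ := kappa σ₀ X η with hκ
  have hκ0 : 0 ≤ κ := by rw [hκ, kappa]; positivity
  have hκeq : κ = σ₀ * η / (3 * X) := rfl
  have hBsplit : ∑ t ∈ T, (famSiftedAbove (normWindow X η) (fun J => J) (uIdeal t) t.2 : ℝ) =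
      ∑ t ∈ T.filter UGood, (famSiftedAbove (normWindow X η) (fun J => J) (uIdeal t) t.2 : ℝ) +
        ∑ t ∈ T.filter (fun t => ¬ UGood t),
          (famSiftedAbove (normWindow X η) (fun J => J) (uIdeal t) t.2 : ℝ) :=
    (sum_filter_add_sum_filter_not T UGood _).symm
  have hBgood := sum_good_weight_le (normWindow X η) (fun J => J) (S := fun R => (siftedB X η R z : ℝ)) hw0
    (fun R => by rw [siftedB_eq_famSifted]) (fun N 𝒮 hN hNX hmem => h7B N z 𝒮 hzτ hN hNX hmem)
    hC₇ (by positivity) (by positivity) hX0 ha2 hab hb hm1 T hT hz hrange'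
  have hBbad := sum_filter_not_UGood_normWindow_le (X := X) (η := η) hcountB T hT
  have hB1 : κ * (C₇ * (η * X ^ 3 / Real.log (min z (X ^ (2 - τ) / b)) *
      ∑ t ∈ T.filter UGood, w (uIdeal t))) ≤ σ₀ * C₇ * mU * Wc / (3 * cm) * B₀ := by
    calc κ * (C₇ * (η * X ^ 3 / Real.log (min z (X ^ (2 - τ) / b)) *
          ∑ t ∈ T.filter UGood, w (uIdeal t)))
        ≤ κ * (C₇ * (η * X ^ 3 / (cm * L) * (mU * (Wc * τ)))) := by
          gcongr
      _ = σ₀ * C₇ * mU * Wc / (3 * cm) * B₀ := by rw [hB₀, hκeq]; field_simp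
  have hB2 : κ * ((Real.log b / Real.log 2 + 1) * (C₇ * X ^ (3 - τ / 5))) ≤ σ₀ * C₇ * B₀ := by
    have hXp : 0 ≤ X ^ (3 - τ / 5) := by positivity
    calc κ * ((Real.log b / Real.log 2 + 1) * (C₇ * X ^ (3 - τ / 5)))
        ≤ κ * (3 * L * (C₇ * X ^ (3 - τ / 5))) := by gcongr
      _ = σ₀ * C₇ * η * (X ^ 2 * X ^ (-(τ / 5)) * L ^ 1) := by
          rw [rpow_three_sub hX0, hκeq]; field_simp
      _ ≤ σ₀ * C₇ * 1 * (X ^ 2 * X ^ (-(τ / 5)) * L ^ 1) := by gcongr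
      _ ≤ σ₀ * C₇ * 1 * B₀ := by
          rw [hB₀]; exact absorb_le hX1 hL1 (by positivity) le_rfl (by norm_num) habs
      _ = σ₀ * C₇ * B₀ := by ring
  have hB3 : κ * (C_B * X ^ 3 * ∑ t ∈ T.filter (fun t => ¬ UGood t),
      ((Ideal.absNorm (uIdeal t) : ℕ) : ℝ)⁻¹) ≤ σ₀ * C_B * Wb / 3 * B₀ := by
    calc κ * (C_B * X ^ 3 * ∑ t ∈ T.filter (fun t => ¬ UGood t), ((Ideal.absNorm (uIdeal t) : ℕ) : ℝ)⁻¹)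
        ≤ κ * (C_B * X ^ 3 * (Wb * L ^ 2 * X ^ (-(1 / 15 : ℝ)))) := by gcongr
      _ = σ₀ * C_B * Wb / 3 * η * (X ^ 2 * X ^ (-(1 / 15 : ℝ)) * L ^ 2) := by
          rw [hκeq]; field_simp
      _ ≤ σ₀ * C_B * Wb / 3 * 1 * (X ^ 2 * X ^ (-(1 / 15 : ℝ)) * L ^ 2) := by gcongr
      _ ≤ σ₀ * C_B * Wb / 3 * 1 * B₀ := by
          rw [hB₀]; exact absorb_le hX1 hL1 (by positivity) (by linarith) (by norm_num) habs
      _ = σ₀ * C_B * Wb / 3 * B₀ := by ring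
  have hBtot : κ * ∑ t ∈ T, (famSiftedAbove (normWindow X η) (fun J => J) (uIdeal t) t.2 : ℝ) ≤
      σ₀ * C₇ * mU * Wc / (3 * cm) * B₀ + σ₀ * C₇ * B₀ + σ₀ * C_B * Wb / 3 * B₀ := by
    rw [hBsplit]
    calc κ * (∑ t ∈ T.filter UGood, (famSiftedAbove (normWindow X η) (fun J => J) (uIdeal t) t.2 : ℝ) +
            ∑ t ∈ T.filter (fun t => ¬ UGood t),
              (famSiftedAbove (normWindow X η) (fun J => J) (uIdeal t) t.2 : ℝ))
        ≤ κ * ((C₇ * (η * X ^ 3 / Real.log (min z (X ^ (2 - τ) / b)) *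
              ∑ t ∈ T.filter UGood, w (uIdeal t)) +
              (Real.log b / Real.log 2 + 1) * (C₇ * X ^ (3 - τ / 5))) +
            C_B * X ^ 3 * ∑ t ∈ T.filter (fun t => ¬ UGood t), ((Ideal.absNorm (uIdeal t) : ℕ) : ℝ)⁻¹) :=
          mul_le_mul_of_nonneg_left (add_le_add hBgood hBbad) hκ0
      _ = κ * (C₇ * (η * X ^ 3 / Real.log (min z (X ^ (2 - τ) / b)) *
              ∑ t ∈ T.filter UGood, w (uIdeal t))) +
            κ * ((Real.log b / Real.log 2 + 1) * (C₇ * X ^ (3 - τ / 5))) +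
            κ * (C_B * X ^ 3 * ∑ t ∈ T.filter (fun t => ¬ UGood t),
              ((Ideal.absNorm (uIdeal t) : ℕ) : ℝ)⁻¹) := by ring
      _ ≤ _ := add_le_add (add_le_add hB1 hB2) hB3
  calc ∑ t ∈ T, (famSiftedAbove (boxPairs X η) pairIdeal (uIdeal t) t.2 : ℝ) +
        κ * ∑ t ∈ T, (famSiftedAbove (normWindow X η) (fun J => J) (uIdeal t) t.2 : ℝ)
      ≤ (C₇ * mU * Wc / cm * B₀ + 3 * C₇ * B₀) +
          (σ₀ * C₇ * mU * Wc / (3 * cm) * B₀ + σ₀ * C₇ * B₀ + σ₀ * C_B * Wb / 3 * B₀) :=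
        add_le_add (hA.trans (add_le_add hA1 hA2)) hBtot
    _ = _ := by ring

/-! ### Numerical facts at `X ≥ 2^{15}` -/

/-- `X^{1/5} ≥ 8`, `X^{1/4} ≥ 2`, `X^{1/2} ≥ 4` for `X ≥ 2^{15}` (resp. `X ≥ 16`). [folklore] -/
theorem rpow_lower_bounds {X : ℝ} (hX : (2 : ℝ) ^ 15 ≤ X) :
    8 ≤ X ^ (1 / 5 : ℝ) ∧ 2 ≤ X ^ (1 / 4 : ℝ) ∧ 4 ≤ X ^ (1 / 2 : ℝ) := by
  have hX16 : 16 ≤ X := le_trans (by norm_num) hX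
  refine ⟨?_, ?_, ?_⟩
  · calc (8 : ℝ) = ((8 : ℝ) ^ 5) ^ ((5 : ℕ) : ℝ)⁻¹ := by
          rw [Real.pow_rpow_inv_natCast (by norm_num) (by norm_num)]
      _ = ((2 : ℝ) ^ 15) ^ (1 / 5 : ℝ) := by norm_num
      _ ≤ X ^ (1 / 5 : ℝ) := Real.rpow_le_rpow (by norm_num) hX (by norm_num)
  · calc (2 : ℝ) = ((2 : ℝ) ^ 4) ^ ((4 : ℕ) : ℝ)⁻¹ := by
          rw [Real.pow_rpow_inv_natCast (by norm_num) (by norm_num)]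
      _ = (16 : ℝ) ^ (1 / 4 : ℝ) := by norm_num
      _ ≤ X ^ (1 / 4 : ℝ) := Real.rpow_le_rpow (by norm_num) hX16 (by norm_num)
  · calc (4 : ℝ) = ((4 : ℝ) ^ 2) ^ ((2 : ℕ) : ℝ)⁻¹ := by
          rw [Real.pow_rpow_inv_natCast (by norm_num) (by norm_num)]
      _ = (16 : ℝ) ^ (1 / 2 : ℝ) := by norm_num
      _ ≤ X ^ (1 / 2 : ℝ) := Real.rpow_le_rpow (by norm_num) hX16 (by norm_num)

end Literature.NumberTheory.Sieve.CubicSieve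

end
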